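import Literature.NumberTheory.Transcendental.NesterenkoElimIdealPrime
import Mathlib.RingTheory.Localization.Away.Basic
import HarnessLib

/-!
# The `U`-eliminant ideal `Ī(r)` over an ARBITRARY field: Philippon's Lemma 1.2 and Proposition 1.3 (iv) — proved

`Literature/NumberTheory/Transcendental/NesterenkoEliminationLocalizationK.lean`. The tree's
`NesterenkoEliminationLocalization.lean` proves, for ideals of `ℚ[x₀, …, x_m]`
(`Nesterenko.elimIdeal`), Philippon's Lemme 1.2 and Prop. 1.3 (ii), (iv) of *Critères pour
l'indépendance algébrique*, Publ. Math. IHÉS 64 (1986) §1 (case `d = (1, …, 1)`) — the algebraic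
backbone of LNM 1752 Ch. 3 Prop. 4.4 (`Ī(r)` of an intersection is the intersection of the `Ī(r)`).
Chapter 10 of LNM 1752 runs Ch. 3 §4 over `K = ℂ(z)` (p. 153), so this file re-runs the SAME
proofs over an arbitrary field `K`, for the generic objects `NesterenkoK.extIdeal`,
`NesterenkoK.elimIdeal`, `NesterenkoK.linForm` of `NesterenkoElimIdealPrime.lean` (the text is the
`ℚ` file with `ℚ ↦ K`; the prime case, Prop. 1.3 (ii), is already generic there:
`NesterenkoK.isPrime_elimIdeal`, and is not repeated):

* **Lemma 1.2** (localisation description). For each `j` let `B_j = (K[x̲]/I)[1/x̄_j]` (`Bloc I j`)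
  and `Θ_j : K[U, x̲] → B_j[U]` (`theta I r j`) the substitution `x_k ↦ x̄_k`, `u_{ik} ↦ u_{ik}`
  (`k ≠ j`), `u_{ij} ↦ -(1/x̄_j) ∑_{k ≠ j} x̄_k u_{ik}` (solving `Lᵢ = 0` for `u_{ij}`; this is
  Philippon's `s_i ∘ b`). Then `Θ_j(P) = 0 ⇔ x_j^M P ∈ (I, L₁, …, L_r)` for some `M`
  (`theta_eq_zero_iff`), hence `G ∈ Ī(r) ⇔ Θ_j(G) = 0` for all `j` (`mem_elimIdeal_iff_theta`).
  Proof: `Θ_j` kills `(I, L)` and `x̄_j` is a unit in `B_j` (easy half); conversely `Θ_j` factors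
  through `C[1/x̄_j]`, `C = K[U, x̲]/(I, L)`, by a map `ψ` which has a left inverse `χ`
  (`u_{ik} ↦ ū_{ik}`; `χ ∘ ψ = id` because `ū_{ij} = -(1/x̄_j) ∑_{k≠j} x̄_k ū_{ik}` in `C[1/x̄_j]`),
  so `Θ_j(P) = 0` forces `P ↦ 0` in `C[1/x̄_j]`, i.e. `x̄_j^M P = 0` in `C`.
* **Prop. 1.3 (iv)**: `(⋂_{Q ∈ t} Q)‾(r) = ⋂_{Q ∈ t} Q̄(r)` (`elimIdeal_finset_inf`,
  `elimIdeal_eq_iInf_of_isMinimalPrimaryDecomposition`), by naturality of `Θ_j` in `I`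
  (`map_piB_comp_theta`) and the fact that an element of `B_j(⋂ Q)` vanishing in every `B_j(Q)`
  vanishes (`eq_zero_of_forall_piB_eq_zero`).

## References

* [Philippon1986Criteres] P. Philippon, *Critères pour l'indépendance algébrique*, Publ. Math.
  IHÉS 64 (1986) 5–52, §1: Déf. 1.1 (p. 9), Lemme 1.2, Prop. 1.3 (pp. 10–11).
* [NesterenkoPhilippon2001] LNM 1752 (2001), Ch. 3 (Yu. V. Nesterenko) §4, Def. 4.3, Prop. 4.4
  (p. 38).
* [HodgePedoe1994] W. V. D. Hodge, D. Pedoe, *Methods of Algebraic Geometry* II (CUP 1952, repr.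
  1994), Ch. X §6 (the Cayley form via the generic point).
-/

noncomputable section

open MvPolynomial

namespace Literature.NumberTheory.Transcendental

namespace NesterenkoK

variable {K : Type*} [Field K] {m : ℕ}

section Theta

variable (I : Ideal (MvPolynomial (Fin (m + 1)) K)) (r : ℕ) (j : Fin (m + 1))

/-- `x̄_k`, the class of `x_k` in `K[x̲]/I`. [folklore] -/
abbrev xq (k : Fin (m + 1)) : (MvPolynomial (Fin (m + 1)) K) ⧸ I := Ideal.Quotient.mk I (X k)

/-- `B_j = (K[x̲]/I)[1/x̄_j]`. [cite: Philippon1986Criteres, Lemme 1.2 (p. 10)] -/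
abbrev Bloc : Type _ := Localization.Away (xq I j)

/-- `x̄_k / 1 ∈ B_j`. [folklore] -/
abbrev xB (k : Fin (m + 1)) : Bloc I j := algebraMap ((MvPolynomial (Fin (m + 1)) K) ⧸ I) (Bloc I j) (xq I k)

/-- `K → B_j`. [folklore] -/
def cB : K →+* Bloc I j := (algebraMap ((MvPolynomial (Fin (m + 1)) K) ⧸ I) (Bloc I j)).comp ((Ideal.Quotient.mk I).comp C)

/-- The value substituted for `u_{ik}` in `B_j[U]`: `u_{ik}` itself for `k ≠ j`, and
`-(1/x̄_j) ∑_{k ≠ j} x̄_k u_{ik}` for `k = j` (solving `Lᵢ = 0` for `u_{ij}`).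
[cite: Philippon1986Criteres, Lemme 1.2 (p. 10)] -/
def thetaU (ik : Fin r × Fin (m + 1)) : MvPolynomial (Fin r × Fin (m + 1)) (Bloc I j) :=
  if ik.2 = j then
    -(C (IsLocalization.Away.invSelf (xq I j)) *
        ∑ k ∈ Finset.univ.erase j, C (xB I j k) * X (ik.1, k))
  else X ik

/-- **Philippon's substitution** `Θ_j : K[U, x̲] → B_j[U]`, `x_k ↦ x̄_k`, `u_{ik} ↦ u_{ik}` (`k ≠ j`),
`u_{ij} ↦ -(1/x̄_j) ∑_{k ≠ j} x̄_k u_{ik}`. [cite: Philippon1986Criteres, Lemme 1.2 (p. 10)] -/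
def theta : (MvPolynomial ((Fin r × Fin (m + 1)) ⊕ Fin (m + 1)) K) →+* MvPolynomial (Fin r × Fin (m + 1)) (Bloc I j) :=
  eval₂Hom (C.comp (cB I j)) (Sum.elim (thetaU I r j) fun k => C (xB I j k))

/-- `Θ_j(x_k) = x̄_k`. [folklore] -/
@[simp] theorem theta_X_inr (k : Fin (m + 1)) : theta I r j (X (Sum.inr k)) = C (xB I j k) := by
  simp [theta]

/-- `Θ_j(u_{ik})` is the substituted value `thetaU`. [folklore] -/
@[simp] theorem theta_X_inl (ik : Fin r × Fin (m + 1)) : theta I r j (X (Sum.inl ik)) = thetaU I r j ik := by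
  simp [theta]

/-- `Θ_j` on constants. [folklore] -/
@[simp] theorem theta_C (c : K) : theta I r j (C c) = C (cB I j c) := by
  simp [theta]

/-- `Θ_j(u_{ik}) = u_{ik}` for `k ≠ j`. [folklore] -/
theorem thetaU_of_ne {ik : Fin r × Fin (m + 1)} (h : ik.2 ≠ j) : thetaU I r j ik = X ik := by
  simp [thetaU, h]

/-- `Θ_j(u_{ij}) = -(1/x̄_j) ∑_{k ≠ j} x̄_k u_{ik}`. [folklore] -/
theorem thetaU_self (i : Fin r) :
    thetaU I r j (i, j) = -(C (IsLocalization.Away.invSelf (xq I j)) *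
        ∑ k ∈ Finset.univ.erase j, C (xB I j k) * X (i, k)) := by
  simp [thetaU]

/-- `Θ_j` on `K[x̲] ⊆ K[U, x̲]` is reduction mod `I` followed by `B_j ⊆ B_j[U]`. [folklore] -/
theorem theta_rename_inr (p : (MvPolynomial (Fin (m + 1)) K)) :
    theta I r j (rename Sum.inr p) = C (algebraMap ((MvPolynomial (Fin (m + 1)) K) ⧸ I) (Bloc I j) (Ideal.Quotient.mk I p)) := by
  have : (theta I r j).comp (rename (Sum.inr : Fin (m + 1) → _)).toRingHom =
      C.comp ((algebraMap ((MvPolynomial (Fin (m + 1)) K) ⧸ I) (Bloc I j)).comp (Ideal.Quotient.mk I)) := by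
    apply MvPolynomial.ringHom_ext
    · intro c
      simp [cB]
    · intro k
      simp
  exact RingHom.congr_fun this p

/-- `x̄_j` is a unit in `B_j[U]`. [folklore] -/
theorem isUnit_C_xB : IsUnit (C (xB I j j) : MvPolynomial (Fin r × Fin (m + 1)) (Bloc I j)) :=
  (IsLocalization.Away.algebraMap_isUnit (xq I j)).map C

/-- `x̄_j · (1/x̄_j) = 1` in `B_j[U]`. [folklore] -/
theorem C_xB_mul_C_invSelf :
    (C (xB I j j) : MvPolynomial (Fin r × Fin (m + 1)) (Bloc I j)) *
      C (IsLocalization.Away.invSelf (xq I j)) = 1 := by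
  rw [← map_mul, IsLocalization.Away.mul_invSelf, map_one]

/-- `Θ_j(Lᵢ) = 0`. [cite: Philippon1986Criteres, Lemme 1.2 (p. 10)] -/
theorem theta_linForm (i : Fin r) : theta I r j (linForm K r m i) = 0 := by
  simp only [linForm, map_sum, map_mul, theta_X_inl, theta_X_inr]
  rw [← Finset.add_sum_erase _ _ (Finset.mem_univ j), thetaU_self]
  have hrest : ∑ k ∈ Finset.univ.erase j, thetaU I r j (i, k) * C (xB I j k) =
      ∑ k ∈ Finset.univ.erase j, C (xB I j k) * X (i, k) := by
    refine Finset.sum_congr rfl fun k hk => ?_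
    rw [thetaU_of_ne I r j (by simpa using Finset.ne_of_mem_erase hk), mul_comm]
  rw [hrest]
  set S := ∑ k ∈ Finset.univ.erase j, C (xB I j k) * X (i, k)
  have h1 := C_xB_mul_C_invSelf I j (r := r)
  linear_combination (-S) * h1

/-- `Θ_j` kills `(I, L₁, …, L_r)`. [cite: Philippon1986Criteres, Lemme 1.2 (p. 10)] -/
theorem extIdeal_le_ker_theta : extIdeal I r ≤ RingHom.ker (theta I r j) := by
  refine sup_le ?_ ?_
  · rw [Ideal.map_le_iff_le_comap]
    intro p hp
    rw [Ideal.mem_comap, RingHom.mem_ker, theta_rename_inr, Ideal.Quotient.eq_zero_iff_mem.2 hp,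
      map_zero, map_zero]
  · rw [Ideal.span_le]
    rintro _ ⟨i, rfl⟩
    exact theta_linForm I r j i

/-- `Θ_j` vanishes on `(I, L₁, …, L_r)`. [folklore] -/
theorem theta_eq_zero_of_mem_extIdeal {P : (MvPolynomial ((Fin r × Fin (m + 1)) ⊕ Fin (m + 1)) K)} (hP : P ∈ extIdeal I r) : theta I r j P = 0 :=
  extIdeal_le_ker_theta I r j hP

/-- Easy half of Lemma 1.2: `x_j^M P ∈ (I, L) ⇒ Θ_j(P) = 0`. [cite: Philippon1986Criteres, Lemme 1.2 (p. 10)] -/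
theorem theta_eq_zero_of_X_pow_mul_mem {P : (MvPolynomial ((Fin r × Fin (m + 1)) ⊕ Fin (m + 1)) K)} {M : ℕ}
    (hP : X (Sum.inr j) ^ M * P ∈ extIdeal I r) : theta I r j P = 0 := by
  have h := theta_eq_zero_of_mem_extIdeal I r j hP
  rw [map_mul, map_pow, theta_X_inr] at h
  exact ((isUnit_C_xB I r j).pow M).mul_right_eq_zero.1 h

end Theta

section Lift

variable (I : Ideal (MvPolynomial (Fin (m + 1)) K)) (r : ℕ) (j : Fin (m + 1))

/-- `C = K[U, x̲]/(I, L₁, …, L_r)`. [folklore] -/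
abbrev Cq : Type _ := (MvPolynomial ((Fin r × Fin (m + 1)) ⊕ Fin (m + 1)) K) ⧸ extIdeal I r

/-- The quotient map `K[U, x̲] → C`. [folklore] -/
abbrev mkE : (MvPolynomial ((Fin r × Fin (m + 1)) ⊕ Fin (m + 1)) K) →+* Cq I r := Ideal.Quotient.mk (extIdeal I r)

/-- The class of `x_j` in `C`. [folklore] -/
abbrev xE : Cq I r := mkE I r (X (Sum.inr j))

/-- `C[1/x̄_j]`. [folklore] -/
abbrev Cloc : Type _ := Localization.Away (xE I r j)

/-- `C → C[1/x̄_j]`. [folklore] -/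
abbrev aC : Cq I r →+* Cloc I r j := algebraMap (Cq I r) (Cloc I r j)

/-- `φ : C → B_j[U]` induced by `Θ_j`. [folklore] -/
def phi : Cq I r →+* MvPolynomial (Fin r × Fin (m + 1)) (Bloc I j) :=
  Ideal.Quotient.lift (extIdeal I r) (theta I r j) fun _ hP => theta_eq_zero_of_mem_extIdeal I r j hP

/-- `φ ∘ (K[U,x̲] → C) = Θ_j`. [folklore] -/
theorem phi_mkE (P : (MvPolynomial ((Fin r × Fin (m + 1)) ⊕ Fin (m + 1)) K)) : phi I r j (mkE I r P) = theta I r j P :=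
  Ideal.Quotient.lift_mk _ _ _

/-- `φ(x̄_j)` is a unit. [folklore] -/
theorem isUnit_phi_xE : IsUnit (phi I r j (xE I r j)) := by
  rw [phi_mkE, theta_X_inr]
  exact isUnit_C_xB I r j

/-- `ψ : C[1/x̄_j] → B_j[U]` induced by `φ`. [folklore] -/
def psi : Cloc I r j →+* MvPolynomial (Fin r × Fin (m + 1)) (Bloc I j) :=
  IsLocalization.Away.lift (xE I r j) (isUnit_phi_xE I r j)

/-- `ψ` extends `φ`. [folklore] -/
theorem psi_aC (c : Cq I r) : psi I r j (aC I r j c) = phi I r j c :=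
  IsLocalization.Away.lift_eq _ _ _

/-- `ρ₀ : K[x̲]/I → C[1/x̄_j]`. [folklore] -/
def rhoB0 : ((MvPolynomial (Fin (m + 1)) K) ⧸ I) →+* Cloc I r j :=
  Ideal.Quotient.lift I ((aC I r j).comp ((mkE I r).comp (rename Sum.inr).toRingHom)) fun p hp => by
    have hmem : rename Sum.inr p ∈ extIdeal I r :=
      Ideal.mem_sup_left (Ideal.mem_map_of_mem (rename Sum.inr) hp)
    have h0 : mkE I r (rename Sum.inr p) = 0 := Ideal.Quotient.eq_zero_iff_mem.2 hmem
    simp only [RingHom.comp_apply, AlgHom.toRingHom_eq_coe, RingHom.coe_coe]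
    rw [h0, map_zero]

/-- `ρ₀` on classes of polynomials. [folklore] -/
theorem rhoB0_mk (p : (MvPolynomial (Fin (m + 1)) K)) : rhoB0 I r j (Ideal.Quotient.mk I p) = aC I r j (mkE I r (rename Sum.inr p)) :=
  Ideal.Quotient.lift_mk _ _ _

/-- `ρ₀(x̄_j)` is a unit. [folklore] -/
theorem isUnit_rhoB0_xq : IsUnit (rhoB0 I r j (xq I j)) := by
  rw [rhoB0_mk, rename_X]
  exact IsLocalization.Away.algebraMap_isUnit (xE I r j)

/-- `ρ : B_j → C[1/x̄_j]` induced by `ρ₀`. [folklore] -/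
def rhoB : Bloc I j →+* Cloc I r j :=
  IsLocalization.Away.lift (xq I j) (isUnit_rhoB0_xq I r j)

/-- `ρ` extends `ρ₀`. [folklore] -/
theorem rhoB_algebraMap (a : (MvPolynomial (Fin (m + 1)) K) ⧸ I) : rhoB I r j (algebraMap _ (Bloc I j) a) = rhoB0 I r j a :=
  IsLocalization.Away.lift_eq _ _ _

/-- `ρ(x̄_k) = x̄_k`. [folklore] -/
theorem rhoB_xB (k : Fin (m + 1)) : rhoB I r j (xB I j k) = aC I r j (mkE I r (X (Sum.inr k))) := by
  rw [rhoB_algebraMap, rhoB0_mk, rename_X]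

/-- `ρ(1/x̄_j) · x̄_j = 1`. [folklore] -/
theorem rhoB_invSelf_mul : rhoB I r j (IsLocalization.Away.invSelf (xq I j)) * aC I r j (xE I r j) = 1 := by
  rw [← rhoB_xB, ← map_mul, mul_comm, IsLocalization.Away.mul_invSelf, map_one]

/-- `χ : B_j[U] → C[1/x̄_j]`, `u_{ik} ↦ ū_{ik}` (a left inverse of `ψ`). [folklore] -/
def chi : MvPolynomial (Fin r × Fin (m + 1)) (Bloc I j) →+* Cloc I r j :=
  eval₂Hom (rhoB I r j) fun ik => aC I r j (mkE I r (X (Sum.inl ik)))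

/-- In `C` (hence in `C[1/x̄_j]`), `Lᵢ = 0`: `ū_{ij} x̄_j + ∑_{k≠j} ū_{ik} x̄_k = 0`. [folklore] -/
theorem aC_linForm_rel (i : Fin r) :
    aC I r j (mkE I r (X (Sum.inl (i, j)))) * aC I r j (xE I r j) +
      ∑ k ∈ Finset.univ.erase j,
        aC I r j (mkE I r (X (Sum.inr k))) * aC I r j (mkE I r (X (Sum.inl (i, k)))) = 0 := by
  have hmem : linForm K r m i ∈ extIdeal I r :=
    Ideal.mem_sup_right (Ideal.subset_span (Set.mem_range_self i))
  have h0 : aC I r j (mkE I r (linForm K r m i)) = 0 := by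
    rw [Ideal.Quotient.eq_zero_iff_mem.2 hmem, map_zero]
  rw [linForm, map_sum, map_sum, ← Finset.add_sum_erase _ _ (Finset.mem_univ j)] at h0
  simp only [map_mul] at h0
  rw [← h0]
  congr 1
  exact Finset.sum_congr rfl fun k _ => mul_comm _ _

/-- `χ ∘ ψ ∘ (C → C[1/x̄_j]) ∘ (K[U,x̲] → C) = (C → C[1/x̄_j]) ∘ (K[U,x̲] → C)`. [folklore] -/
theorem chi_psi_aC_mkE :
    ((chi I r j).comp (psi I r j)).comp ((aC I r j).comp (mkE I r)) = (aC I r j).comp (mkE I r) := by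
  apply MvPolynomial.ringHom_ext
  · intro c
    simp only [RingHom.comp_apply, psi_aC, phi_mkE, theta_C, chi, eval₂Hom_C, cB, rhoB_algebraMap,
      rhoB0_mk, rename_C]
  · rintro (⟨i, k⟩ | k)
    · by_cases hk : k = j
      · subst hk
        simp only [RingHom.comp_apply, psi_aC, phi_mkE, theta_X_inl, thetaU_self, map_neg, map_mul,
          map_sum, chi, eval₂Hom_C, eval₂Hom_X', rhoB_xB]
        have h1 := rhoB_invSelf_mul I r k
        have h2 := aC_linForm_rel I r k i
        set ri := rhoB I r k (IsLocalization.Away.invSelf (xq I k))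
        set S := ∑ x ∈ Finset.univ.erase k,
          aC I r k (mkE I r (X (Sum.inr x))) * aC I r k (mkE I r (X (Sum.inl (i, x))))
        linear_combination (-ri) * h2 + (aC I r k (mkE I r (X (Sum.inl (i, k))))) * h1
      · simp only [RingHom.comp_apply, psi_aC, phi_mkE, theta_X_inl,
          thetaU_of_ne I r j (show (i, k).2 ≠ j from hk), chi, eval₂Hom_X']
    · simp only [RingHom.comp_apply, psi_aC, phi_mkE, theta_X_inr, chi, eval₂Hom_C, rhoB_xB]

/-- `χ ∘ ψ = id`: `ψ` is injective. [folklore] -/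
theorem chi_comp_psi : (chi I r j).comp (psi I r j) = RingHom.id _ := by
  apply IsLocalization.ringHom_ext (Submonoid.powers (xE I r j))
  apply Ideal.Quotient.ringHom_ext
  rw [RingHom.comp_assoc, RingHom.id_comp]
  exact chi_psi_aC_mkE I r j

/-- Hard half of Lemma 1.2: `Θ_j(P) = 0 ⇒ x_j^M P ∈ (I, L)` for some `M`.
[cite: Philippon1986Criteres, Lemme 1.2 (p. 10)] -/
theorem exists_X_pow_mul_mem_of_theta_eq_zero {P : (MvPolynomial ((Fin r × Fin (m + 1)) ⊕ Fin (m + 1)) K)} (h : theta I r j P = 0) :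
    ∃ M : ℕ, X (Sum.inr j) ^ M * P ∈ extIdeal I r := by
  have h1 : psi I r j (aC I r j (mkE I r P)) = 0 := by rw [psi_aC, phi_mkE, h]
  have h2 : aC I r j (mkE I r P) = 0 := by
    have := congrArg (chi I r j) h1
    rwa [map_zero, ← RingHom.comp_apply, chi_comp_psi, RingHom.id_apply] at this
  obtain ⟨⟨_, n, rfl⟩, hc⟩ :=
    (IsLocalization.map_eq_zero_iff (Submonoid.powers (xE I r j)) (Cloc I r j) _).1 h2
  refine ⟨n, ?_⟩
  rw [← Ideal.Quotient.eq_zero_iff_mem, map_mul, map_pow]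
  exact hc

/-- **Philippon's Lemma 1.2, kernel form**: `Θ_j(P) = 0 ⇔ x_j^M P ∈ (I, L₁, …, L_r)` for some `M`.
[cite: Philippon1986Criteres, Lemme 1.2 (p. 10)] -/
theorem theta_eq_zero_iff (P : (MvPolynomial ((Fin r × Fin (m + 1)) ⊕ Fin (m + 1)) K)) :
    theta I r j P = 0 ↔ ∃ M : ℕ, X (Sum.inr j) ^ M * P ∈ extIdeal I r :=
  ⟨exists_X_pow_mul_mem_of_theta_eq_zero I r j, fun ⟨_, hM⟩ => theta_eq_zero_of_X_pow_mul_mem I r j hM⟩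

end Lift

/-- **Philippon's Lemma 1.2** (for `d = (1, …, 1)`, `R = K`): `G ∈ Ī(r)` iff `Θ_j(G) = 0` in
`B_j[U] = (K[x̲]/I)[1/x̄_j][U]` for every `j`. [cite: Philippon1986Criteres, Lemme 1.2 (p. 10)] -/
theorem mem_elimIdeal_iff_theta (I : Ideal (MvPolynomial (Fin (m + 1)) K)) (r : ℕ) (G : (MvPolynomial (Fin r × Fin (m + 1)) K)) :
    G ∈ elimIdeal I r ↔ ∀ j, theta I r j (rename Sum.inl G) = 0 := by
  constructor
  · rintro ⟨M, -, hM⟩ j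
    refine theta_eq_zero_of_X_pow_mul_mem I r j (M := M) ?_
    rw [mul_comm]
    exact hM j
  · intro h
    choose M hM using fun j => exists_X_pow_mul_mem_of_theta_eq_zero I r j (h j)
    refine ⟨Finset.univ.sup M + 1, Nat.succ_pos _, fun j => ?_⟩
    have hle : M j ≤ Finset.univ.sup M := Finset.le_sup (f := M) (Finset.mem_univ j)
    have e : rename Sum.inl G * X (Sum.inr j) ^ (Finset.univ.sup M + 1) =
        X (Sum.inr j) ^ (Finset.univ.sup M + 1 - M j) * (X (Sum.inr j) ^ M j * rename Sum.inl G) := by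
      rw [← mul_assoc, ← pow_add, Nat.sub_add_cancel (by omega), mul_comm]
    rw [e]
    exact Ideal.mul_mem_left _ _ (hM j)

/-! ### Functoriality in `I` and Proposition 1.3 (iv): `Ī(r)` of an intersection -/

section Functorial

variable {I Q : Ideal (MvPolynomial (Fin (m + 1)) K)} (h : I ≤ Q) (r : ℕ) (j : Fin (m + 1))

/-- Powers of `x̄_j` map to powers of `x̄_j` under `K[x̲]/I → K[x̲]/Q`. [folklore] -/
theorem powers_le_comap_factor :
    Submonoid.powers (xq I j) ≤ (Submonoid.powers (xq Q j)).comap (Ideal.Quotient.factor h) := by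
  rintro _ ⟨n, rfl⟩
  exact ⟨n, by rw [map_pow, Ideal.Quotient.factor_mk]⟩

/-- The natural map `B_j(I) → B_j(Q)` for `I ⊆ Q`. [folklore] -/
def piB : Bloc I j →+* Bloc Q j :=
  IsLocalization.map (M := Submonoid.powers (xq I j)) (T := Submonoid.powers (xq Q j)) (Bloc Q j)
    (Ideal.Quotient.factor h) (powers_le_comap_factor h j)

/-- `B_j(I) → B_j(Q)` extends `K[x̲]/I → K[x̲]/Q`. [folklore] -/
theorem piB_algebraMap (a : (MvPolynomial (Fin (m + 1)) K) ⧸ I) :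
    piB h j (algebraMap _ (Bloc I j) a) = algebraMap _ (Bloc Q j) (Ideal.Quotient.factor h a) :=
  IsLocalization.map_eq _ _

/-- `B_j(I) → B_j(Q)` maps `x̄_k` to `x̄_k`. [folklore] -/
theorem piB_xB (k : Fin (m + 1)) : piB h j (xB I j k) = xB Q j k := by
  rw [piB_algebraMap, Ideal.Quotient.factor_mk]

/-- `B_j(I) → B_j(Q)` maps `1/x̄_j` to `1/x̄_j`. [folklore] -/
theorem piB_invSelf :
    piB h j (IsLocalization.Away.invSelf (xq I j)) = IsLocalization.Away.invSelf (xq Q j) := by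
  have hu : IsUnit (xB Q j j) := IsLocalization.Away.algebraMap_isUnit (xq Q j)
  have h1 : piB h j (IsLocalization.Away.invSelf (xq I j)) * xB Q j j = 1 := by
    rw [← piB_xB h j j, ← map_mul, mul_comm, IsLocalization.Away.mul_invSelf, map_one]
  have h2 : IsLocalization.Away.invSelf (xq Q j) * xB Q j j = 1 := by
    rw [mul_comm, IsLocalization.Away.mul_invSelf]
  exact hu.mul_left_inj.1 (h1.trans h2.symm)

/-- Naturality of `Θ_j` in `I`: `Θ_j^Q = (B_j(I) → B_j(Q)) ∘ Θ_j^I`. [folklore] -/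
theorem map_piB_comp_theta : (MvPolynomial.map (piB h j)).comp (theta I r j) = theta Q r j := by
  apply MvPolynomial.ringHom_ext
  · intro c
    simp only [RingHom.comp_apply, theta_C, map_C, cB, piB_algebraMap, Ideal.Quotient.factor_mk]
  · rintro (⟨i, k⟩ | k)
    · by_cases hk : k = j
      · subst hk
        simp only [RingHom.comp_apply, theta_X_inl, thetaU_self, map_neg, map_mul, map_sum, map_C,
          map_X, piB_xB, piB_invSelf]
      · simp only [RingHom.comp_apply, theta_X_inl, thetaU_of_ne _ _ _ (show (i, k).2 ≠ j from hk),
          map_X]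
    · simp only [RingHom.comp_apply, theta_X_inr, map_C, piB_xB]

/-- Naturality of `Θ_j` in `I`, pointwise. [folklore] -/
theorem theta_eq_map_piB_theta (P : (MvPolynomial ((Fin r × Fin (m + 1)) ⊕ Fin (m + 1)) K)) : theta Q r j P = MvPolynomial.map (piB h j) (theta I r j P) := by
  rw [← map_piB_comp_theta h r j]
  rfl

end Functorial

/-- An element of `B_j(⋂_{Q ∈ t} Q)` vanishing in every `B_j(Q)` is zero. [folklore] -/
theorem eq_zero_of_forall_piB_eq_zero {t : Finset (Ideal (MvPolynomial (Fin (m + 1)) K))} {j : Fin (m + 1)}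
    {b : Bloc (t.inf id) j}
    (hb : ∀ (Q : Ideal (MvPolynomial (Fin (m + 1)) K)) (hQ : Q ∈ t), piB (show t.inf id ≤ Q from Finset.inf_le hQ) j b = 0) :
    b = 0 := by
  classical
  obtain ⟨⟨a, s⟩, rfl⟩ := IsLocalization.mk'_surjective (Submonoid.powers (xq (t.inf id) j)) b
  obtain ⟨p, rfl⟩ := Ideal.Quotient.mk_surjective a
  -- in each `B_j(Q)`: `x_j^{n_Q} p ∈ Q`
  have hQ : ∀ Q ∈ t, ∃ n : ℕ, (X j : (MvPolynomial (Fin (m + 1)) K)) ^ n * p ∈ Q := by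
    intro Q hQ
    have h0 := hb Q hQ
    simp only [piB, IsLocalization.map_mk', IsLocalization.mk'_eq_zero_iff] at h0
    obtain ⟨⟨_, n, rfl⟩, hn⟩ := h0
    refine ⟨n, ?_⟩
    rw [← Ideal.Quotient.eq_zero_iff_mem, map_mul, map_pow]
    have hn' : xq Q j ^ n * Ideal.Quotient.mk Q p = 0 := by
      rw [← Ideal.Quotient.factor_mk (show t.inf id ≤ Q from Finset.inf_le hQ) p]
      exact hn
    exact hn'
  choose! n hn using hQ
  set N := t.sup n with hN
  have hmem : (X j : (MvPolynomial (Fin (m + 1)) K)) ^ N * p ∈ t.inf id := by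
    refine Submodule.mem_finsetInf.2 fun Q hQ => ?_
    have hle : n Q ≤ N := Finset.le_sup (f := n) hQ
    have e : (X j : (MvPolynomial (Fin (m + 1)) K)) ^ N * p = X j ^ (N - n Q) * (X j ^ n Q * p) := by
      rw [← mul_assoc, ← pow_add, Nat.sub_add_cancel hle]
    rw [e]
    exact Ideal.mul_mem_left _ _ (hn Q hQ)
  rw [IsLocalization.mk'_eq_zero_iff]
  refine ⟨⟨xq (t.inf id) j ^ N, N, rfl⟩, ?_⟩
  change xq (t.inf id) j ^ N * Ideal.Quotient.mk _ p = 0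
  rw [← map_pow, ← map_mul, Ideal.Quotient.eq_zero_iff_mem]
  exact hmem

/-- `Θ_j` over `⋂ Q` vanishes on `P` as soon as every `Θ_j^Q` does. [folklore] -/
theorem theta_finset_inf_eq_zero {t : Finset (Ideal (MvPolynomial (Fin (m + 1)) K))} {r : ℕ} {j : Fin (m + 1)} {P : (MvPolynomial ((Fin r × Fin (m + 1)) ⊕ Fin (m + 1)) K)}
    (h : ∀ Q ∈ t, theta Q r j P = 0) : theta (t.inf id) r j P = 0 := by
  ext d
  rw [coeff_zero]
  refine eq_zero_of_forall_piB_eq_zero fun Q hQ => ?_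
  have hle : t.inf id ≤ Q := Finset.inf_le hQ
  have := congrArg (coeff d) (theta_eq_map_piB_theta hle r j P)
  rw [h Q hQ, coeff_zero, coeff_map] at this
  exact this.symm

/-- **Philippon's Proposition 1.3 (iv)** (for `d = (1, …, 1)`, `R = K`): the `U`-eliminant ideal of a
finite intersection is the intersection of the `U`-eliminant ideals, `(⋂ Q)‾(r) = ⋂ Q̄(r)`.
[cite: Philippon1986Criteres, Prop. 1.3 (iv) (pp. 10–11)] -/
theorem elimIdeal_finset_inf (t : Finset (Ideal (MvPolynomial (Fin (m + 1)) K))) (r : ℕ) :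
    elimIdeal (t.inf id) r = ⨅ Q ∈ t, elimIdeal Q r := by
  apply le_antisymm
  · refine le_iInf₂ fun Q hQ G hG => ?_
    rw [mem_elimIdeal_iff_theta] at hG ⊢
    intro j
    have hle : t.inf id ≤ Q := Finset.inf_le hQ
    rw [theta_eq_map_piB_theta hle r j, hG j, map_zero]
  · intro G hG
    rw [mem_elimIdeal_iff_theta]
    intro j
    refine theta_finset_inf_eq_zero fun Q hQ => ?_
    have hGQ : G ∈ elimIdeal Q r := by
      have h1 := (Submodule.mem_iInf _).1 hG Q
      exact (Submodule.mem_iInf _).1 h1 hQ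
    exact (mem_elimIdeal_iff_theta Q r G).1 hGQ j

/-- Prop. 1.3 (iv) for a (minimal) primary decomposition `I = ⋂_{Q ∈ t} Q`.
[cite: Philippon1986Criteres, Prop. 1.3 (iv) (pp. 10–11)] -/
theorem elimIdeal_eq_iInf_of_isMinimalPrimaryDecomposition {I : Ideal (MvPolynomial (Fin (m + 1)) K)} {t : Finset (Ideal (MvPolynomial (Fin (m + 1)) K))}
    (ht : Submodule.IsMinimalPrimaryDecomposition I t) (r : ℕ) :
    elimIdeal I r = ⨅ Q ∈ t, elimIdeal Q r := by
  rw [← elimIdeal_finset_inf, ht.inf_eq]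

end NesterenkoK

end Literature.NumberTheory.Transcendental

end
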